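import Literature.NumberTheory.Transcendental.RoyPadicRankThm5Proofs
import HarnessLib

/-!
# Roy 1992 for `K = ℚ̄_p`: the vocabulary of Theorems 1–2 and Roy's category `𝒞` (§§1–2)

Topic `Literature/NumberTheory/Transcendental` (namespace `Literature.NumberTheory.Transcendental`,
grouping sub-namespace `RoyPadic`). Companion of `RoyPadicRank` (the NAMED FACTS
`roy1992_padic_thm4`, `roy1992_padic_thm5`, `roy1992_padic_cor1` for the `p`-adic field
`K = ℚ̄_p = PadicAlgCl p`, `ℚ̄ = padicQbar p`) and `RoyPadicRankThm5Proofs` (Theorem 4 ⇒ Theorem 5,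
proved). This file and its sequels formalize, for the `p`-adic field, the printed deduction of
**Theorem 4 from Theorem 1** ([Roy1992] §§2–4): Theorem 1 is M. Waldschmidt's transcendence theorem
(Theorem 4.1 of [Waldschmidt1988] for the group `G_a^{d₀} × G_m^{d₁}`, valid over `ℂ` and over
`ℂ_p`), Theorem 2 is Roy's refinement of it (§§2–3, through the category `𝒞` and the abstract
Theorem 3), and Theorem 4 follows from Theorem 2 (§4). The COMPLEX case of exactly this chain is
in the tree (`Literature.Barriers.Schanuel.AlgebraicIndependenceOfLogarithmsRoy*`,
`…Thm4FromThm2*`, resting on the named fact `roy1992_thm1`); the present files are the `p`-ADIC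
port, with two differences taken from the source: `ω = 0` ("`ω` the element of `L` equal to `2πi`
if `K = ℂ`, equal to `0` otherwise", Notations p. 24), so `Ω = 0 × ωℚ^{d₁} = 0` and Roy's function
`a(X) = d₁ − dim_ℚ(Y ∩ Ω)` is just `d₁`; and `L` = the `ℚ`-span of the `p`-adic logarithms of the
algebraic principal units (`RoyPadic.logQSpan p`).

NO NAMED FACT is introduced here (D-0026): Waldschmidt's `p`-adic Theorem 1 is NOT vendored as a
`Prop`; it enters the reduction theorems as an explicit HYPOTHESIS, spelled with the two predicates
`RoyPadic.IsThmOneDatum Y W V` (the printed hypotheses on `(d₀, d₁, Y, W, V)`) and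
`RoyPadic.ThmOneConclusion Y W V` (the printed conclusion), i.e. Theorem 1 reads
`∀ d₀ d₁ Y W V, IsThmOneDatum Y W V → V ≠ ⊤ → ThmOneConclusion Y W V`.

## What the source prints [Roy1992, §1 pp. 24–25, §2 pp. 26–27]

* Theorem 1 (M. Waldschmidt): "Let `d₀, d₁` be integers `≥ 0`, `Y` be a finite dimensional
  `ℚ`-vector subspace of `K^{d₀} × K^{d₁}` contained in `ℚ̄^{d₀} × L^{d₁}`, `W` be a `K`-vector
  subspace of `K^{d₀} × K^{d₁}` which is rational over `ℚ̄`, `V` be a `K`-vector subspace of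
  `K^{d₀} × K^{d₁}` containing `Y` and `W`. If `V ≠ K^{d₀} × K^{d₁}`, there exists a surjective
  `K`-linear mapping `s : K^{d₀} × K^{d₁} → K^{d₀'} × K^{d₁'}` satisfying `s(ℚ̄^{d₀} × 0) ⊆ ℚ̄^{d₀'} × 0`
  and `s(0 × ℚ^{d₁}) ⊆ 0 × ℚ^{d₁'}`, such that, letting `Y' = s(Y)`, `W' = s(W)`, `V' = s(V)`,
  `Ω = 0 × ωℚ^{d₁}`, `Ω' = 0 × ωℚ^{d₁'}`, we have `W' ≠ K^{d₀'} × K^{d₁'}` and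
  `(d₁' − dim_ℚ(Y' ∩ Ω') + dim_ℚ(Y')) / (d₀' + d₁' − dim_K(W')) ≤ (d₁ − dim_ℚ(Y ∩ Ω)) / (d₀ + d₁ − dim_K(V))`."
* Theorem 2: "Let `d₀, d₁, Y, W, V` be as in Theorem 1, with `V ≠ K^{d₀} × K^{d₁}`. Consider the set
  of all surjective `K`-linear mappings `s : K^{d₀} × K^{d₁} → K^{d₀'} × K^{d₁'}` satisfying
  `s(ℚ̄^{d₀} × 0) ⊆ ℚ̄^{d₀'} × 0`, `s(0 × ℚ^{d₁}) ⊆ 0 × ℚ^{d₁'}`, `s(V) ≠ K^{d₀'} × K^{d₁'}`. In this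
  set, there exists at least one mapping `s` for which the ratio `d₁'/(d₀' + d₁' − dim_K(s(V)))` is
  minimal, and for which `s(V) ∩ (ℚ̄^{d₀'} × 0) = 0`. For such an `s`, we have
  `(d₁' + dim_ℚ(s(Y))) / (d₀' + d₁' − dim_K(s(W))) ≤ d₁'/(d₀' + d₁' − dim_K(s(V))) ≤ (d₁ − dim_ℚ(Y ∩ Ω)) / (d₀ + d₁ − dim_K(V))`."
* §2 (pp. 26–27): the category `𝒞` — objects `(K^{d₀} × K^{d₁}, Y, W, V)`, morphisms the `K`-linear
  `f` with `f(ℚ̄^{d₀₁} × 0) ⊂ ℚ̄^{d₀₂} × 0`, `f(0 × ℚ^{d₁₁}) ⊂ 0 × ℚ^{d₁₂}`, `f(Y₁) ⊂ Y₂`, `f(W₁) ⊂ W₂`,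
  `f(V₁) ⊂ V₂`; kernels (injective, `Y* = i⁻¹(Y)`, …) and cokernels (surjective, `Y' = s(Y)`, …);
  the functions `a(X) = d₁ − dim_ℚ(Y ∩ Ω)`, `b(X) = d₀ + d₁ − dim_K(V)`, `c(X) = dim_ℚ(Y)`,
  `d(X) = dim_K(V/W)`, `r(X) = d₀ + d₁`, `d₀(X)`, `d₁(X)`; Theorem 1bis and Theorem 2bis.

## Contents (port of `…RoyThm12` (definitions only) and `…RoyCategory`; everything proved)

`RoyPadic.LinTangent p d₀ d₁ = K^{d₀} × K^{d₁}`; `IsQbarPoint`, `IsQbarRational`, `IsAdmissible`,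
`IsQbarLogSubspace` (`Y ⊆ ℚ̄^{d₀} × L^{d₁}`), `thm2Ratio`, `IsThm2Minimal`; the predicates
`IsThmOneDatum`, `ThmOneConclusion`, `ThmTwoConclusion`; `RoyPadic.Obj p` and the morphisms
(`IsBiRational`, products `f₀ × f₁` of a `ℚ̄`-matrix and a `ℚ`-matrix), the image object `mapObj`,
`IsCokerMap`/`IsKerMap`, the functions `fa … fd₁`, the dictionary `thm2Ratio = d₁(X')/b(X')`,
`noBadKernel_iff` (bad kernels ⟺ `s(V) ∩ (ℚ̄^{d₀'} × 0) ≠ 0`), Theorem 1bis object by object from the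
hypothesis "Theorem 1", and `IsCokerMap.isThm2Minimal_iff`.

## References

* [Roy1992] D. Roy, *Matrices whose coefficients are linear forms in logarithms*, J. Number
  Theory 41 (1992) 22–47: Notations p. 24; §1 Theorems 1–2 (p. 25); §2 (pp. 26–27).
* [Waldschmidt1988] M. Waldschmidt, *On the transcendence methods of Gel'fond and Schneider in
  several variables*, New Advances in Transcendence Theory (1988), §4 Theorem 4.1.
-/

noncomputable section

open Module Submodule

namespace Literature.NumberTheory.Transcendental.RoyPadic

open Literature.Barriers.Schanuel.Roy1992 (eq_zero_of_forall_single)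

/-! ### The ambient space `K^{d₀} × K^{d₁}` and its rational structures (`K = ℚ̄_p`) -/

/-- The tangent space `K^{d₀} × K^{d₁}` (`K = ℚ̄_p = PadicAlgCl p`) of the linear group
`G_a^{d₀} × G_m^{d₁}` at the neutral element. [cite: Roy1992, §1 (before Theorem 1, p. 25)] -/
abbrev LinTangent (p : ℕ) [Fact p.Prime] (d₀ d₁ : ℕ) : Type :=
  (Fin d₀ → PadicAlgCl p) × (Fin d₁ → PadicAlgCl p)

variable {p : ℕ} [Fact p.Prime] {d₀ d₁ d₀' d₁' d₀'' d₁'' : ℕ}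

/-- `v ∈ ℚ̄^{d₀} × ℚ̄^{d₁}` (all coordinates algebraic). [cite: Roy1992, Notations (p. 24)] -/
def IsQbarPoint (v : LinTangent p d₀ d₁) : Prop :=
  (∀ i, v.1 i ∈ padicQbar p) ∧ ∀ j, v.2 j ∈ padicQbar p

/-- A `K`-subspace `W ⊆ K^{d₀} × K^{d₁}` is **rational over `ℚ̄`** if it is generated over `K` by
elements of `ℚ̄^{d₀} × ℚ̄^{d₁}` (it is the `K`-span of its own `ℚ̄`-points).
[cite: Roy1992, Notations (p. 24)] -/
def IsQbarRational (W : Submodule (PadicAlgCl p) (LinTangent p d₀ d₁)) : Prop :=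
  W = Submodule.span (PadicAlgCl p) {v | v ∈ W ∧ IsQbarPoint v}

/-- The maps `s : K^{d₀} × K^{d₁} → K^{d₀'} × K^{d₁'}` of Theorems 1–2: surjective, `K`-linear, with
`s(ℚ̄^{d₀} × 0) ⊆ ℚ̄^{d₀'} × 0` and `s(0 × ℚ^{d₁}) ⊆ 0 × ℚ^{d₁'}` (`ℚ ⊂ K` through `algebraMap ℚ K`).
[cite: Roy1992, §1 Theorem 1 (p. 25)] -/
def IsAdmissible (s : LinTangent p d₀ d₁ →ₗ[PadicAlgCl p] LinTangent p d₀' d₁') : Prop :=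
  Function.Surjective s ∧
    (∀ x : Fin d₀ → PadicAlgCl p, (∀ i, x i ∈ padicQbar p) →
      (∀ i, (s (x, 0)).1 i ∈ padicQbar p) ∧ (s (x, 0)).2 = 0) ∧
    (∀ y : Fin d₁ → PadicAlgCl p, (∀ j, y j ∈ Set.range (algebraMap ℚ (PadicAlgCl p))) →
      (s (0, y)).1 = 0 ∧ ∀ j, (s (0, y)).2 j ∈ Set.range (algebraMap ℚ (PadicAlgCl p)))

/-- The identity is admissible. [folklore] -/
theorem isAdmissible_id (d₀ d₁ : ℕ) :
    IsAdmissible (LinearMap.id : LinTangent p d₀ d₁ →ₗ[PadicAlgCl p] LinTangent p d₀ d₁) :=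
  ⟨Function.surjective_id, fun _ hx => ⟨hx, rfl⟩, fun _ hy => ⟨rfl, hy⟩⟩

/-- The zero subspace is rational over `ℚ̄`. [folklore] -/
theorem isQbarRational_bot : IsQbarRational (⊥ : Submodule (PadicAlgCl p) (LinTangent p d₀ d₁)) := by
  unfold IsQbarRational
  refine le_antisymm bot_le (Submodule.span_le.2 ?_)
  rintro v ⟨hv, -⟩
  exact hv

/-- `Y ⊆ ℚ̄^{d₀} × L^{d₁}`: the first `d₀` coordinates of every element of `Y` are algebraic and the
last `d₁` lie in Roy's `L` — for the `p`-adic field, the `ℚ`-span `RoyPadic.logQSpan p` of the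
`p`-adic logarithms of the algebraic principal units. [cite: Roy1992, §1 Theorem 1 (p. 25) with Notations (p. 24)] -/
def IsQbarLogSubspace (Y : Submodule ℚ (LinTangent p d₀ d₁)) : Prop :=
  ∀ y ∈ Y, (∀ i, y.1 i ∈ padicQbar p) ∧ ∀ j, y.2 j ∈ logQSpan p

/-- The ratio `d₁'/(d₀' + d₁' − dim_K(s(V)))` minimised in Theorem 2. [cite: Roy1992, §1 Theorem 2 (p. 25)] -/
def thm2Ratio (V : Submodule (PadicAlgCl p) (LinTangent p d₀ d₁)) (d₀' d₁' : ℕ)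
    (s : LinTangent p d₀ d₁ →ₗ[PadicAlgCl p] LinTangent p d₀' d₁') : ℝ :=
  (d₁' : ℝ) / ((d₀' : ℝ) + d₁' - finrank (PadicAlgCl p) ↥(V.map s))

/-- The set of maps considered in Theorem 2: admissible `s` with `s(V) ≠ K^{d₀'} × K^{d₁'}`, and the
minimality of the ratio `d₁'/(d₀' + d₁' − dim_K(s(V)))` over that set.
[cite: Roy1992, §1 Theorem 2 (p. 25)] -/
def IsThm2Minimal (V : Submodule (PadicAlgCl p) (LinTangent p d₀ d₁)) (d₀' d₁' : ℕ)
    (s : LinTangent p d₀ d₁ →ₗ[PadicAlgCl p] LinTangent p d₀' d₁') : Prop :=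
  IsAdmissible s ∧ V.map s ≠ ⊤ ∧
    ∀ (d₀'' d₁'' : ℕ) (s' : LinTangent p d₀ d₁ →ₗ[PadicAlgCl p] LinTangent p d₀'' d₁''),
      IsAdmissible s' → V.map s' ≠ ⊤ → thm2Ratio V d₀' d₁' s ≤ thm2Ratio V d₀'' d₁'' s'

/-! ### Theorems 1 and 2 as predicates on the datum `(d₀, d₁, Y, W, V)` (hypotheses, never asserted) -/

/-- **"`d₀, d₁, Y, W, V` as in Theorem 1"**: `Y` a finite dimensional `ℚ`-subspace of `K^{d₀} × K^{d₁}`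
contained in `ℚ̄^{d₀} × L^{d₁}`, `W` a `K`-subspace rational over `ℚ̄`, `V` a `K`-subspace containing
`Y` and `W` (the condition `V ≠ K^{d₀} × K^{d₁}` is kept apart, as printed).
[cite: Roy1992, §1 Theorem 1 (p. 25)] -/
structure IsThmOneDatum (Y : Submodule ℚ (LinTangent p d₀ d₁))
    (W V : Submodule (PadicAlgCl p) (LinTangent p d₀ d₁)) : Prop where
  /-- `Y` is finite dimensional over `ℚ` -/
  finite : FiniteDimensional ℚ Y
  /-- `Y ⊆ ℚ̄^{d₀} × L^{d₁}` -/
  isLog : IsQbarLogSubspace Y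
  /-- `W` is rational over `ℚ̄` -/
  isRat : IsQbarRational W
  /-- `Y ⊆ V` -/
  hYV : Y ≤ V.restrictScalars ℚ
  /-- `W ⊆ V` -/
  hWV : W ≤ V

/-- **The conclusion of Theorem 1 (M. Waldschmidt) for the datum `(d₀, d₁, Y, W, V)`, `p`-adic field**
(`Ω = 0`): "there exists a surjective `K`-linear mapping `s : K^{d₀} × K^{d₁} → K^{d₀'} × K^{d₁'}`
satisfying `s(ℚ̄^{d₀} × 0) ⊆ ℚ̄^{d₀'} × 0` and `s(0 × ℚ^{d₁}) ⊆ 0 × ℚ^{d₁'}`, such that, letting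
`Y' = s(Y)`, `W' = s(W)`, `V' = s(V)`, we have `W' ≠ K^{d₀'} × K^{d₁'}` and
`(d₁' + dim_ℚ(Y')) / (d₀' + d₁' − dim_K(W')) ≤ d₁ / (d₀ + d₁ − dim_K(V))`" (dimensions cast to `ℝ`;
images of the `ℚ`-space `Y` under `s` restricted to `ℚ`-scalars). A PREDICATE: Theorem 1 for
`K = ℚ̄_p` is the (unproved, not vendored) statement `∀ d₀ d₁ Y W V, IsThmOneDatum Y W V → V ≠ ⊤ →
ThmOneConclusion Y W V`, which the reduction theorems take as a hypothesis.
[cite: Roy1992, §1 Theorem 1 (p. 25)] [cite: Waldschmidt1988, §4 Theorem 4.1] -/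
def ThmOneConclusion (Y : Submodule ℚ (LinTangent p d₀ d₁))
    (W V : Submodule (PadicAlgCl p) (LinTangent p d₀ d₁)) : Prop :=
  ∃ (d₀' d₁' : ℕ) (s : LinTangent p d₀ d₁ →ₗ[PadicAlgCl p] LinTangent p d₀' d₁'), IsAdmissible s ∧
    W.map s ≠ ⊤ ∧
    ((d₁' : ℝ) + finrank ℚ ↥(Y.map (s.restrictScalars ℚ))) /
        ((d₀' : ℝ) + d₁' - finrank (PadicAlgCl p) ↥(W.map s)) ≤
      (d₁ : ℝ) / ((d₀ : ℝ) + d₁ - finrank (PadicAlgCl p) ↥V)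

/-- **The conclusion of Theorem 2 for the datum `(d₀, d₁, Y, W, V)`, `p`-adic field** (`Ω = 0`): "In
this set [of admissible `s` with `s(V) ≠ K^{d₀'} × K^{d₁'}`], there exists at least one mapping `s`
for which the ratio `d₁'/(d₀' + d₁' − dim_K(s(V)))` is minimal, and for which
`s(V) ∩ (ℚ̄^{d₀'} × 0) = 0`. For such an `s`, we have
`(d₁' + dim_ℚ(s(Y))) / (d₀' + d₁' − dim_K(s(W))) ≤ d₁'/(d₀' + d₁' − dim_K(s(V))) ≤ d₁/(d₀ + d₁ − dim_K(V))`"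
(rendered, as in the complex-case `roy1992_thm2`, as the existence statement and the inequalities for
every minimising `s` with `s(V) ∩ (ℚ̄^{d₀'} × 0) = 0`). A PREDICATE, proved below from the
hypothesis "Theorem 1" (`RoyPadic.thmTwo_of_thmOne`, next file). [cite: Roy1992, §1 Theorem 2 (p. 25)] -/
def ThmTwoConclusion (Y : Submodule ℚ (LinTangent p d₀ d₁))
    (W V : Submodule (PadicAlgCl p) (LinTangent p d₀ d₁)) : Prop :=
  (∃ (d₀' d₁' : ℕ) (s : LinTangent p d₀ d₁ →ₗ[PadicAlgCl p] LinTangent p d₀' d₁'),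
      IsThm2Minimal V d₀' d₁' s ∧
      ∀ v ∈ V.map s, (∀ i, v.1 i ∈ padicQbar p) → v.2 = 0 → v = 0) ∧
    ∀ (d₀' d₁' : ℕ) (s : LinTangent p d₀ d₁ →ₗ[PadicAlgCl p] LinTangent p d₀' d₁'),
      IsThm2Minimal V d₀' d₁' s →
      (∀ v ∈ V.map s, (∀ i, v.1 i ∈ padicQbar p) → v.2 = 0 → v = 0) →
      ((d₁' : ℝ) + finrank ℚ ↥(Y.map (s.restrictScalars ℚ))) /
            ((d₀' : ℝ) + d₁' - finrank (PadicAlgCl p) ↥(W.map s)) ≤ thm2Ratio V d₀' d₁' s ∧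
        thm2Ratio V d₀' d₁' s ≤ (d₁ : ℝ) / ((d₀ : ℝ) + d₁ - finrank (PadicAlgCl p) ↥V)

/-! ### Objects -/

/-- **The objects of Roy's category `𝒞`**: "the families `(K^{d₀} × K^{d₁}, Y, W, V)` where
`d₀, d₁, Y, W, V` are as in Theorem 1" — `Y` a finite-dimensional `ℚ`-subspace of `K^{d₀} × K^{d₁}`
contained in `ℚ̄^{d₀} × L^{d₁}`, `W` a `K`-subspace rational over `ℚ̄`, `V` a `K`-subspace containing
`Y` and `W`. [cite: Roy1992, §2 (p. 26)] -/
structure Obj (p : ℕ) [Fact p.Prime] where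
  /-- `d₀` -/
  d₀ : ℕ
  /-- `d₁` -/
  d₁ : ℕ
  /-- `Y ⊆ ℚ̄^{d₀} × L^{d₁}`, a finite-dimensional `ℚ`-subspace -/
  Y : Submodule ℚ (LinTangent p d₀ d₁)
  /-- `W`, a `K`-subspace rational over `ℚ̄` -/
  W : Submodule (PadicAlgCl p) (LinTangent p d₀ d₁)
  /-- `V ⊇ Y, W` -/
  V : Submodule (PadicAlgCl p) (LinTangent p d₀ d₁)
  finite : FiniteDimensional ℚ Y
  isLog : IsQbarLogSubspace Y
  isRat : IsQbarRational W
  hYV : Y ≤ V.restrictScalars ℚ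
  hWV : W ≤ V

/-- `Y` is finite dimensional over `ℚ`. [cite: Roy1992, §1 Theorem 1 (p. 25)] -/
instance Obj.instFiniteDimensionalY (X : Obj p) : FiniteDimensional ℚ X.Y := X.finite


/-! ### Morphisms: the two rationality conditions -/

/-- The rationality conditions on the underlying linear map of a morphism of `𝒞`:
`f(ℚ̄^{d₀} × 0) ⊆ ℚ̄^{d₀'} × 0` and `f(0 × ℚ^{d₁}) ⊆ 0 × ℚ^{d₁'}` (so that `IsAdmissible f` is
`Surjective f ∧ IsBiRational f`). [cite: Roy1992, §2 (p. 26)] -/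
def IsBiRational (f : LinTangent p d₀ d₁ →ₗ[PadicAlgCl p] LinTangent p d₀' d₁') : Prop :=
  (∀ x : Fin d₀ → PadicAlgCl p, (∀ i, x i ∈ padicQbar p) →
      (∀ i, (f (x, 0)).1 i ∈ padicQbar p) ∧ (f (x, 0)).2 = 0) ∧
    (∀ y : Fin d₁ → PadicAlgCl p, (∀ j, y j ∈ Set.range (algebraMap ℚ (PadicAlgCl p))) →
      (f (0, y)).1 = 0 ∧ ∀ j, (f (0, y)).2 j ∈ Set.range (algebraMap ℚ (PadicAlgCl p)))

/-- `IsAdmissible f ↔ Surjective f ∧ IsBiRational f` (by definition). [cite: Roy1992, §1 Theorem 1 (p. 25)] -/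
theorem isAdmissible_iff (f : LinTangent p d₀ d₁ →ₗ[PadicAlgCl p] LinTangent p d₀' d₁') :
    IsAdmissible f ↔ Function.Surjective f ∧ IsBiRational f := Iff.rfl

/-- The identity is a morphism. [folklore] -/
theorem IsBiRational.id (d₀ d₁ : ℕ) :
    IsBiRational (LinearMap.id : LinTangent p d₀ d₁ →ₗ[PadicAlgCl p] LinTangent p d₀ d₁) :=
  (isAdmissible_id d₀ d₁).2

/-- Morphisms compose. [cite: Roy1992, §2 (p. 26)] -/
theorem IsBiRational.comp {g : LinTangent p d₀' d₁' →ₗ[PadicAlgCl p] LinTangent p d₀'' d₁''}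
    {f : LinTangent p d₀ d₁ →ₗ[PadicAlgCl p] LinTangent p d₀' d₁'} (hg : IsBiRational g) (hf : IsBiRational f) :
    IsBiRational (g ∘ₗ f) := by
  refine ⟨fun x hx => ?_, fun y hy => ?_⟩
  · obtain ⟨h1, h2⟩ := hf.1 x hx
    have hfx : f (x, 0) = ((f (x, 0)).1, 0) := by ext1 <;> simp [h2]
    rw [LinearMap.comp_apply, hfx]
    exact hg.1 _ h1
  · obtain ⟨h1, h2⟩ := hf.2 y hy
    have hfy : f (0, y) = (0, (f (0, y)).2) := by ext1 <;> simp [h1]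
    rw [LinearMap.comp_apply, hfy]
    exact hg.2 _ h2

/-- Admissible maps compose. [folklore] -/
theorem isAdmissible_comp {g : LinTangent p d₀' d₁' →ₗ[PadicAlgCl p] LinTangent p d₀'' d₁''}
    {f : LinTangent p d₀ d₁ →ₗ[PadicAlgCl p] LinTangent p d₀' d₁'} (hg : IsAdmissible g) (hf : IsAdmissible f) :
    IsAdmissible (g ∘ₗ f) :=
  ⟨hg.1.comp hf.1, IsBiRational.comp hg.2 hf.2⟩

/-- **Morphisms are products `f₀ × f₁`** of a map given by a matrix over `ℚ̄` and a map given by a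
matrix over `ℚ` (the off-diagonal blocks of `f` vanish on the standard bases, the diagonal blocks
have algebraic, resp. rational, matrices). [cite: Roy1992, §2 proof of Proposition 2 (p. 28) and §4 (p. 35)] -/
theorem exists_eq_prodMap_of_isBiRational {f : LinTangent p d₀ d₁ →ₗ[PadicAlgCl p] LinTangent p d₀' d₁'}
    (hf : IsBiRational f) :
    ∃ (A₀ : Matrix (Fin d₀') (Fin d₀) (padicQbar p)) (A₁ : Matrix (Fin d₁') (Fin d₁) ℚ),
      f = (A₀.map (algebraMap (padicQbar p) (PadicAlgCl p))).mulVecLin.prodMap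
            (A₁.map (algebraMap ℚ (PadicAlgCl p))).mulVecLin := by
  obtain ⟨h0, h1⟩ := hf
  set f₀ : (Fin d₀ → PadicAlgCl p) →ₗ[PadicAlgCl p] (Fin d₀' → PadicAlgCl p) :=
    LinearMap.fst (PadicAlgCl p) _ _ ∘ₗ f ∘ₗ LinearMap.inl (PadicAlgCl p) _ _ with hf₀
  set f₁ : (Fin d₁ → PadicAlgCl p) →ₗ[PadicAlgCl p] (Fin d₁' → PadicAlgCl p) :=
    LinearMap.snd (PadicAlgCl p) _ _ ∘ₗ f ∘ₗ LinearMap.inr (PadicAlgCl p) _ _ with hf₁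
  have hsingle0 : ∀ i : Fin d₀, ∀ k, (Pi.single i (1 : PadicAlgCl p) : Fin d₀ → PadicAlgCl p) k ∈ padicQbar p := by
    intro i k
    by_cases h : k = i
    · subst h; simp
    · simp [h]
  have hsingle1 : ∀ j : Fin d₁, ∀ k,
      (Pi.single j (1 : PadicAlgCl p) : Fin d₁ → PadicAlgCl p) k ∈ Set.range (algebraMap ℚ (PadicAlgCl p)) := by
    intro j k
    by_cases h : k = j
    · subst h; exact ⟨1, by simp⟩
    · exact ⟨0, by simp [h]⟩
  have hoff0 : (LinearMap.snd (PadicAlgCl p) _ _ ∘ₗ f ∘ₗ LinearMap.inl (PadicAlgCl p) _ (Fin d₁ → PadicAlgCl p)) = 0 :=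
    eq_zero_of_forall_single _ fun i => (h0 _ (hsingle0 i)).2
  have hoff1 : (LinearMap.fst (PadicAlgCl p) _ _ ∘ₗ f ∘ₗ LinearMap.inr (PadicAlgCl p) (Fin d₀ → PadicAlgCl p) _) = 0 :=
    eq_zero_of_forall_single _ fun j => (h1 _ (hsingle1 j)).1
  have hdec : ∀ x y, f (x, y) = (f₀ x, f₁ y) := by
    intro x y
    have hx : f (x, 0) = (f₀ x, 0) := by
      ext1
      · rfl
      · exact congrArg (fun g => g x) (congrArg DFunLike.coe hoff0)
    have hy : f (0, y) = (0, f₁ y) := by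
      ext1
      · exact congrArg (fun g => g y) (congrArg DFunLike.coe hoff1)
      · rfl
    calc f (x, y) = f ((x, 0) + (0, y)) := by simp
      _ = (f₀ x, f₁ y) := by rw [map_add, hx, hy]; simp
  have hA₀mem : ∀ i j, LinearMap.toMatrix' f₀ i j ∈ padicQbar p := by
    intro i j
    rw [LinearMap.toMatrix'_apply]
    exact (h0 _ (hsingle0 j)).1 i
  have hA₁mem : ∀ i j, LinearMap.toMatrix' f₁ i j ∈ Set.range (algebraMap ℚ (PadicAlgCl p)) := by
    intro i j
    rw [LinearMap.toMatrix'_apply]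
    exact (h1 _ (hsingle1 j)).2 i
  let A₀ : Matrix (Fin d₀') (Fin d₀) (padicQbar p) := fun i j => ⟨_, hA₀mem i j⟩
  let A₁ : Matrix (Fin d₁') (Fin d₁) ℚ := fun i j => Classical.choose (hA₁mem i j)
  have hA₀ : A₀.map (algebraMap (padicQbar p) (PadicAlgCl p)) = LinearMap.toMatrix' f₀ := by
    ext i j; rfl
  have hA₁ : A₁.map (algebraMap ℚ (PadicAlgCl p)) = LinearMap.toMatrix' f₁ := by
    ext i j
    exact Classical.choose_spec (hA₁mem i j)
  have hm₀ : (A₀.map (algebraMap (padicQbar p) (PadicAlgCl p))).mulVecLin = f₀ := by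
    rw [hA₀, ← Matrix.toLin'_apply', Matrix.toLin'_toMatrix']
  have hm₁ : (A₁.map (algebraMap ℚ (PadicAlgCl p))).mulVecLin = f₁ := by
    rw [hA₁, ← Matrix.toLin'_apply', Matrix.toLin'_toMatrix']
  refine ⟨A₀, A₁, ?_⟩
  rw [hm₀, hm₁]
  refine LinearMap.ext fun p => ?_
  obtain ⟨x, y⟩ := p
  rw [hdec, LinearMap.prodMap_apply]

/-- A product `f₀ × f₁` of a map given by a matrix over `ℚ̄` and a map given by a matrix over `ℚ`
is a morphism. [cite: Roy1992, §2 (p. 26)] -/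
theorem isBiRational_prodMap (A₀ : Matrix (Fin d₀') (Fin d₀) (padicQbar p))
    (A₁ : Matrix (Fin d₁') (Fin d₁) ℚ) :
    IsBiRational ((A₀.map (algebraMap (padicQbar p) (PadicAlgCl p))).mulVecLin.prodMap
      (A₁.map (algebraMap ℚ (PadicAlgCl p))).mulVecLin) := by
  refine ⟨fun x hx => ⟨fun i => ?_, ?_⟩, fun y hy => ⟨?_, fun j => ?_⟩⟩
  · simp only [LinearMap.prodMap_apply, Matrix.mulVecLin_apply, Matrix.mulVec, dotProduct,
      Matrix.map_apply]
    exact sum_mem fun j _ => mul_mem (SetLike.coe_mem _) (hx j)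
  · simp
  · simp
  · simp only [LinearMap.prodMap_apply, Matrix.mulVecLin_apply, Matrix.mulVec, dotProduct,
      Matrix.map_apply]
    choose q hq using hy
    refine ⟨∑ k, A₁ j k * q k, ?_⟩
    rw [map_sum]
    exact Finset.sum_congr rfl fun k _ => by rw [map_mul, hq k]

/-- Morphisms map `ℚ̄`-points to `ℚ̄`-points. [cite: Roy1992, §2 (p. 26)] -/
theorem IsBiRational.isQbarPoint {f : LinTangent p d₀ d₁ →ₗ[PadicAlgCl p] LinTangent p d₀' d₁'}
    (hf : IsBiRational f) {v : LinTangent p d₀ d₁} (hv : IsQbarPoint v) : IsQbarPoint (f v) := by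
  obtain ⟨A₀, A₁, rfl⟩ := exists_eq_prodMap_of_isBiRational hf
  obtain ⟨x, y⟩ := v
  refine ⟨fun i => ?_, fun j => ?_⟩
  · simp only [LinearMap.prodMap_apply, Matrix.mulVecLin_apply, Matrix.mulVec, dotProduct,
      Matrix.map_apply]
    exact sum_mem fun k _ => mul_mem (SetLike.coe_mem _) (hv.1 k)
  · simp only [LinearMap.prodMap_apply, Matrix.mulVecLin_apply, Matrix.mulVec, dotProduct,
      Matrix.map_apply]
    refine sum_mem fun k _ => mul_mem ?_ (hv.2 k)
    rw [mem_algebraicClosure_iff]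
    exact isAlgebraic_algebraMap _

/-- Morphisms map `ℚ`-subspaces of `ℚ̄^{d₀} × L^{d₁}` to `ℚ`-subspaces of `ℚ̄^{d₀'} × L^{d₁'}` (the
second block is a matrix over `ℚ`, and `L = logQSpan p` is a `ℚ`-subspace).
[cite: Roy1992, §2 (p. 26)] -/
theorem IsBiRational.isQbarLogSubspace_map {f : LinTangent p d₀ d₁ →ₗ[PadicAlgCl p] LinTangent p d₀' d₁'}
    (hf : IsBiRational f) {Y : Submodule ℚ (LinTangent p d₀ d₁)} (hY : IsQbarLogSubspace Y) :
    IsQbarLogSubspace (Y.map (f.restrictScalars ℚ)) := by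
  obtain ⟨A₀, A₁, rfl⟩ := exists_eq_prodMap_of_isBiRational hf
  rintro _ ⟨⟨x, y⟩, hyY, rfl⟩
  obtain ⟨hx, hy⟩ := hY _ hyY
  refine ⟨fun i => ?_, fun j => ?_⟩
  · simp only [LinearMap.restrictScalars_apply, LinearMap.prodMap_apply, Matrix.mulVecLin_apply,
      Matrix.mulVec, dotProduct, Matrix.map_apply]
    exact sum_mem fun k _ => mul_mem (SetLike.coe_mem _) (hx k)
  · simp only [LinearMap.restrictScalars_apply, LinearMap.prodMap_apply, Matrix.mulVecLin_apply,
      Matrix.mulVec, dotProduct, Matrix.map_apply]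
    refine sum_mem fun k _ => ?_
    rw [Algebra.algebraMap_eq_smul_one, smul_mul_assoc, one_mul]
    exact Submodule.smul_mem _ _ (hy k)

/-- Morphisms map subspaces rational over `ℚ̄` to subspaces rational over `ℚ̄`.
[cite: Roy1992, §2 (p. 26)] -/
theorem IsBiRational.isQbarRational_map {f : LinTangent p d₀ d₁ →ₗ[PadicAlgCl p] LinTangent p d₀' d₁'}
    (hf : IsBiRational f) {W : Submodule (PadicAlgCl p) (LinTangent p d₀ d₁)} (hW : IsQbarRational W) :
    IsQbarRational (W.map f) := by
  unfold IsQbarRational at hW ⊢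
  refine le_antisymm ?_ (Submodule.span_le.2 fun v hv => hv.1)
  have h1 : W.map f = Submodule.span (PadicAlgCl p) (f '' {v | v ∈ W ∧ IsQbarPoint v}) := by
    conv_lhs => rw [hW]
    rw [LinearMap.map_span]
  refine h1.le.trans (Submodule.span_mono ?_)
  rintro _ ⟨v, ⟨hvW, hvq⟩, rfl⟩
  exact ⟨Submodule.mem_map_of_mem hvW, hf.isQbarPoint hvq⟩

namespace Obj

/-- **The image object** `X' = (K^{d₀'} × K^{d₁'}, s(Y), s(W), s(V))` of an admissible (or merely
bi-rational) map `s`: "Then `X'` is an object of `𝒞`". [cite: Roy1992, §2 proof of Proposition 3 (p. 29)] -/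
def mapObj (X : Obj p) (s : LinTangent p X.d₀ X.d₁ →ₗ[PadicAlgCl p] LinTangent p d₀' d₁') (hs : IsBiRational s) :
    Obj p where
  d₀ := d₀'
  d₁ := d₁'
  Y := X.Y.map (s.restrictScalars ℚ)
  W := X.W.map s
  V := X.V.map s
  finite := inferInstance
  isLog := hs.isQbarLogSubspace_map X.isLog
  isRat := hs.isQbarRational_map X.isRat
  hYV := by
    rw [Submodule.map_le_iff_le_comap]
    intro y hy
    exact ⟨y, X.hYV hy, rfl⟩
  hWV := Submodule.map_mono X.hWV

/-- `s(X)` lives in `K^{d₀'} × K^{d₁'}`. [folklore] -/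
@[simp] theorem mapObj_d₀ (X : Obj p) (s : LinTangent p X.d₀ X.d₁ →ₗ[PadicAlgCl p] LinTangent p d₀' d₁')
    (hs : IsBiRational s) : (X.mapObj s hs).d₀ = d₀' := rfl

/-- `s(X)` lives in `K^{d₀'} × K^{d₁'}`. [folklore] -/
@[simp] theorem mapObj_d₁ (X : Obj p) (s : LinTangent p X.d₀ X.d₁ →ₗ[PadicAlgCl p] LinTangent p d₀' d₁')
    (hs : IsBiRational s) : (X.mapObj s hs).d₁ = d₁' := rfl

/-- `Y' = s(Y)`. [cite: Roy1992, §2 (p. 26)] -/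
@[simp] theorem mapObj_Y (X : Obj p) (s : LinTangent p X.d₀ X.d₁ →ₗ[PadicAlgCl p] LinTangent p d₀' d₁')
    (hs : IsBiRational s) : (X.mapObj s hs).Y = X.Y.map (s.restrictScalars ℚ) := rfl

/-- `W' = s(W)`. [cite: Roy1992, §2 (p. 26)] -/
@[simp] theorem mapObj_W (X : Obj p) (s : LinTangent p X.d₀ X.d₁ →ₗ[PadicAlgCl p] LinTangent p d₀' d₁')
    (hs : IsBiRational s) : (X.mapObj s hs).W = X.W.map s := rfl

/-- `V' = s(V)`. [cite: Roy1992, §2 (p. 26)] -/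
@[simp] theorem mapObj_V (X : Obj p) (s : LinTangent p X.d₀ X.d₁ →ₗ[PadicAlgCl p] LinTangent p d₀' d₁')
    (hs : IsBiRational s) : (X.mapObj s hs).V = X.V.map s := rfl

/-- **Cokernels of `𝒞`**: "`(X, X', s)` is a cokernel of `𝒞` if the linear mapping `s` is
surjective and satisfies `Y' = s(Y)`, `W' = s(W)`, `V' = s(V)`" (`s` a morphism).
[cite: Roy1992, §2 (p. 26)] -/
def IsCokerMap (X X' : Obj p) (s : LinTangent p X.d₀ X.d₁ →ₗ[PadicAlgCl p] LinTangent p X'.d₀ X'.d₁) : Prop :=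
  IsAdmissible s ∧ X'.Y = X.Y.map (s.restrictScalars ℚ) ∧ X'.W = X.W.map s ∧ X'.V = X.V.map s

/-- **Kernels of `𝒞`**: "`(X*, X, i)` is a kernel of `𝒞` if the linear mapping `i` is injective and
satisfies `Y* = i⁻¹(Y)`, `W* = i⁻¹(W)`, `V* = i⁻¹(V)`" (`i` a morphism). [cite: Roy1992, §2 (p. 26)] -/
def IsKerMap (A X : Obj p) (i : LinTangent p A.d₀ A.d₁ →ₗ[PadicAlgCl p] LinTangent p X.d₀ X.d₁) : Prop :=
  Function.Injective i ∧ IsBiRational i ∧ A.Y = X.Y.comap (i.restrictScalars ℚ) ∧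
    A.W = X.W.comap i ∧ A.V = X.V.comap i

/-- `(X, s(X), s)` is a cokernel for every admissible `s`. [cite: Roy1992, §2 proof of Proposition 3 (p. 29)] -/
theorem isCokerMap_mapObj (X : Obj p) {s : LinTangent p X.d₀ X.d₁ →ₗ[PadicAlgCl p] LinTangent p d₀' d₁'}
    (hs : IsAdmissible s) : X.IsCokerMap (X.mapObj s hs.2) s :=
  ⟨hs, rfl, rfl, rfl⟩

/-- The identity is a cokernel `X → X`. [folklore] -/
theorem isCokerMap_id (X : Obj p) : X.IsCokerMap X LinearMap.id :=
  ⟨isAdmissible_id _ _, by simp [LinearMap.restrictScalars_id], by simp, by simp⟩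

/-- The identity is a kernel `X → X`. [folklore] -/
theorem isKerMap_id (X : Obj p) : X.IsKerMap X LinearMap.id :=
  ⟨Function.injective_id, IsBiRational.id _ _, by simp [LinearMap.restrictScalars_id], by simp,
    by simp⟩

/-- Cokernels compose. [cite: Roy1992, §2 Proposition 1 (p. 27)] -/
theorem IsCokerMap.comp {X X' X'' : Obj p} {s : LinTangent p X.d₀ X.d₁ →ₗ[PadicAlgCl p] LinTangent p X'.d₀ X'.d₁}
    {s' : LinTangent p X'.d₀ X'.d₁ →ₗ[PadicAlgCl p] LinTangent p X''.d₀ X''.d₁} (hs : X.IsCokerMap X' s)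
    (hs' : X'.IsCokerMap X'' s') : X.IsCokerMap X'' (s' ∘ₗ s) := by
  obtain ⟨h1, h2, h3, h4⟩ := hs
  obtain ⟨h1', h2', h3', h4'⟩ := hs'
  refine ⟨isAdmissible_comp h1' h1, ?_, ?_, ?_⟩
  · rw [h2', h2, LinearMap.restrictScalars_comp, Submodule.map_comp]
  · rw [h3', h3, Submodule.map_comp]
  · rw [h4', h4, Submodule.map_comp]

/-- Kernels compose. [cite: Roy1992, §2 Proposition 1 (p. 27)] -/
theorem IsKerMap.comp {A' A X : Obj p} {i' : LinTangent p A'.d₀ A'.d₁ →ₗ[PadicAlgCl p] LinTangent p A.d₀ A.d₁}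
    {i : LinTangent p A.d₀ A.d₁ →ₗ[PadicAlgCl p] LinTangent p X.d₀ X.d₁} (hi' : A'.IsKerMap A i')
    (hi : A.IsKerMap X i) : A'.IsKerMap X (i ∘ₗ i') := by
  obtain ⟨h1, h2, h3, h4, h5⟩ := hi
  obtain ⟨h1', h2', h3', h4', h5'⟩ := hi'
  refine ⟨h1.comp h1', h2.comp h2', ?_, ?_, ?_⟩
  · rw [h3', h3, LinearMap.restrictScalars_comp, Submodule.comap_comp]
  · rw [h4', h4, Submodule.comap_comp]
  · rw [h5', h5, Submodule.comap_comp]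

end Obj

/-! ### The functions `a, b, c, d, r, d₀, d₁` -/

/-- `a(X) = d₁ − dim_ℚ(Y ∩ Ω)`, `Ω = 0 × ωℚ^{d₁}`; for the `p`-adic field `ω = 0` (Roy, Notations
p. 24: "`ω` the element of `L` equal to `2πi` if `K = ℂ`, equal to `0` otherwise"), so `Ω = 0` and
`a(X) = d₁`. [cite: Roy1992, §2 (p. 27) with Notations (p. 24)] -/
def fa (X : Obj p) : ℕ := X.d₁

/-- `b(X) = d₀ + d₁ − dim_K(V)`. [cite: Roy1992, §2 (p. 27)] -/
def fb (X : Obj p) : ℕ := X.d₀ + X.d₁ - finrank (PadicAlgCl p) X.V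

/-- `c(X) = dim_ℚ(Y)`. [cite: Roy1992, §2 (p. 27)] -/
def fc (X : Obj p) : ℕ := finrank ℚ X.Y

/-- `d(X) = dim_K(V/W)` (`= dim_K V − dim_K W`, `W ⊆ V`). [cite: Roy1992, §2 (p. 27)] -/
def fd (X : Obj p) : ℕ := finrank (PadicAlgCl p) X.V - finrank (PadicAlgCl p) X.W

/-- `r(X) = d₀ + d₁`. [cite: Roy1992, §2 (p. 27)] -/
def fr (X : Obj p) : ℕ := X.d₀ + X.d₁

/-- `d₀(X) = d₀`. [cite: Roy1992, §2 (p. 27)] -/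
def fd₀ (X : Obj p) : ℕ := X.d₀

/-- `d₁(X) = d₁`. [cite: Roy1992, §2 (p. 27)] -/
def fd₁ (X : Obj p) : ℕ := X.d₁

/-- `dim_K (K^{d₀} × K^{d₁}) = d₀ + d₁`. [folklore] -/
theorem finrank_linTangent (d₀ d₁ : ℕ) : finrank (PadicAlgCl p) (LinTangent p d₀ d₁) = d₀ + d₁ := by
  rw [Module.finrank_prod, Module.finrank_fin_fun, Module.finrank_fin_fun]

namespace Obj

variable (X : Obj p)

/-- `dim_K V ≤ d₀ + d₁`. [folklore] -/
theorem finrank_V_le : finrank (PadicAlgCl p) X.V ≤ X.d₀ + X.d₁ := by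
  rw [← finrank_linTangent (p := p)]
  exact Submodule.finrank_le _

/-- `dim_K W ≤ dim_K V`. [folklore] -/
theorem finrank_W_le : finrank (PadicAlgCl p) X.W ≤ finrank (PadicAlgCl p) X.V :=
  Submodule.finrank_mono X.hWV

/-- `a(X)` in `ℝ` (`= d₁`, since `Ω = 0` for the `p`-adic field). [folklore] -/
theorem cast_fa : ((fa X : ℕ) : ℝ) = (X.d₁ : ℝ) := rfl

/-- `b(X)` in `ℝ`. [folklore] -/
theorem cast_fb : ((fb X : ℕ) : ℝ) = (X.d₀ : ℝ) + X.d₁ - finrank (PadicAlgCl p) X.V := by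
  unfold fb
  rw [Nat.cast_sub X.finrank_V_le, Nat.cast_add]

/-- `b(X) + d(X) = d₀ + d₁ − dim_K W` in `ℝ`. [folklore] -/
theorem cast_fb_add_fd : ((fb X : ℕ) : ℝ) + fd X = (X.d₀ : ℝ) + X.d₁ - finrank (PadicAlgCl p) X.W := by
  unfold fd
  rw [cast_fb, Nat.cast_sub X.finrank_W_le]
  ring

/-- `a(X) ≤ d₁(X)` (first assertion of Proposition 3; an equality for the `p`-adic field).
[cite: Roy1992, §2 Proposition 3 (p. 28)] -/
theorem fa_le_fd₁ : fa X ≤ fd₁ X := le_rfl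

/-- `b(X) ≠ 0 ↔ V ≠ K^{d₀} × K^{d₁}`. [folklore] -/
theorem fb_ne_zero_iff : fb X ≠ 0 ↔ X.V ≠ ⊤ := by
  unfold fb
  constructor
  · intro h hV
    apply h
    rw [hV, finrank_top, finrank_linTangent, Nat.sub_self]
  · intro hV h
    apply hV
    apply Submodule.eq_top_of_finrank_eq
    rw [finrank_linTangent]
    have := X.finrank_V_le
    omega

/-- `b(X') + d(X') ≠ 0 ↔ W' ≠ K^{d₀'} × K^{d₁'}`. [folklore] -/
theorem fb_add_fd_ne_zero_iff : fb X + fd X ≠ 0 ↔ X.W ≠ ⊤ := by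
  unfold fb fd
  have h1 := X.finrank_V_le
  have h2 := X.finrank_W_le
  constructor
  · intro h hW
    apply h
    have : finrank (PadicAlgCl p) X.W = X.d₀ + X.d₁ := by rw [hW, finrank_top, finrank_linTangent]
    omega
  · intro hW h
    apply hW
    apply Submodule.eq_top_of_finrank_eq
    rw [finrank_linTangent]
    omega

/-- **The ratio of Theorem 2 is `d₁(X')/b(X')`**: for a cokernel `(X, X', s)`,
`d₁'/(d₀' + d₁' − dim_K(s(V))) = d₁(X')/b(X')`. [cite: Roy1992, §2 Theorem 2bis (p. 27)] -/
theorem thm2Ratio_eq {X X' : Obj p} {s : LinTangent p X.d₀ X.d₁ →ₗ[PadicAlgCl p] LinTangent p X'.d₀ X'.d₁}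
    (hs : X.IsCokerMap X' s) : thm2Ratio X.V X'.d₀ X'.d₁ s = (fd₁ X' : ℝ) / fb X' := by
  rw [cast_fb, thm2Ratio, ← hs.2.2.2]
  rfl

/-! ### Bad kernels versus `s(V) ∩ (ℚ̄^{d₀'} × 0) = 0` -/

/-- Every `K`-subspace of `K¹ × K⁰` is rational over `ℚ̄` (it is `0` or spanned by `(1, 0)`). [folklore] -/
theorem isQbarRational_of_one_zero (T : Submodule (PadicAlgCl p) (LinTangent p 1 0)) : IsQbarRational T := by
  unfold IsQbarRational
  refine le_antisymm (fun u hu => ?_) (Submodule.span_le.2 fun v hv => hv.1)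
  by_cases hu0 : u.1 0 = 0
  · have : u = 0 := by
      ext i
      · rw [Subsingleton.elim i 0, hu0]; rfl
      · exact Fin.elim0 i
    rw [this]
    exact Submodule.zero_mem _
  · -- `e = (u.1 0)⁻¹ • u = (1, 0)` is a `ℚ̄`-point of `T` and `u = (u.1 0) • e`
    set e : LinTangent p 1 0 := (u.1 0)⁻¹ • u with he
    have heT : e ∈ T := Submodule.smul_mem _ _ hu
    have heq : IsQbarPoint e := by
      refine ⟨fun i => ?_, fun j => Fin.elim0 j⟩
      rw [Subsingleton.elim i 0, he, Prod.smul_fst, Pi.smul_apply, smul_eq_mul,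
        inv_mul_cancel₀ hu0]
      exact one_mem _
    have hu : u = (u.1 0) • e := by
      rw [he, smul_smul, mul_inv_cancel₀ hu0, one_smul]
    rw [hu]
    exact Submodule.smul_mem _ _ (Submodule.subset_span ⟨heT, heq⟩)

/-- **"No kernel `i : X* → X'` with `d₁(X*) = b(X*) = 0` and `r(X*) ≠ 0`" is
"`V' ∩ (ℚ̄^{d₀'} × 0) = 0`"** (the translation between Theorem 2bis and Theorem 2): such a kernel
has `V* = K^{d₀*} × K^{d₁*}` with `d₀* > 0` and sends `(e₁, 0)` to a non-zero point of
`V' ∩ (ℚ̄^{d₀'} × 0)`; conversely a non-zero `v ∈ V' ∩ (ℚ̄^{d₀'} × 0)` gives the kernel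
`K¹ × K⁰ → K^{d₀'} × K^{d₁'}`, `t ↦ t v`, with `d₁(X*) = 0`, `b(X*) = 0`, `r(X*) = 1`.
[cite: Roy1992, §1 Theorem 2 (p. 25) and §2 Theorem 2bis (p. 27)] -/
theorem noBadKernel_iff (X' : Obj p) :
    (¬ ∃ (A : Obj p) (i : LinTangent p A.d₀ A.d₁ →ₗ[PadicAlgCl p] LinTangent p X'.d₀ X'.d₁),
        A.IsKerMap X' i ∧ fd₁ A = 0 ∧ fb A = 0 ∧ fr A ≠ 0) ↔
      ∀ v ∈ X'.V, (∀ k, v.1 k ∈ padicQbar p) → v.2 = 0 → v = 0 := by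
  constructor
  · intro hno v hvV hv1 hv2
    by_contra hv0
    apply hno
    -- the kernel `K¹ × K⁰ → K^{d₀'} × K^{d₁'}`, `(t, u) ↦ t 0 • v`
    let i : LinTangent p 1 0 →ₗ[PadicAlgCl p] LinTangent p X'.d₀ X'.d₁ :=
      (LinearMap.proj (0 : Fin 1) ∘ₗ LinearMap.fst (PadicAlgCl p) (Fin 1 → PadicAlgCl p) (Fin 0 → PadicAlgCl p)).smulRight v
    have hi : ∀ p : LinTangent p 1 0, i p = p.1 0 • v := fun p => rfl
    have hinj : Function.Injective i := by
      rw [injective_iff_map_eq_zero]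
      intro p hp
      rw [hi, smul_eq_zero] at hp
      rcases hp with hp | hp
      · ext k
        · rw [Subsingleton.elim k 0, hp]; rfl
        · exact Fin.elim0 k
      · exact absurd hp hv0
    have hbi : IsBiRational i := by
      refine ⟨fun x hx => ⟨fun k => ?_, ?_⟩, fun y _ => ⟨?_, fun j => ⟨0, ?_⟩⟩⟩
      · rw [hi, Prod.smul_fst, Pi.smul_apply, smul_eq_mul]
        exact mul_mem (hx 0) (hv1 k)
      · rw [hi, Prod.smul_snd, hv2, smul_zero]
      · rw [hi]; simp
      · rw [hi]; simp
    -- some coordinate of `v.1` is a non-zero algebraic number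
    obtain ⟨k₀, hk₀⟩ : ∃ k, v.1 k ≠ 0 := by
      by_contra hall
      simp only [not_exists, not_not] at hall
      exact hv0 (Prod.ext (funext hall) hv2)
    haveI := X'.finite
    let A : Obj p :=
      { d₀ := 1
        d₁ := 0
        Y := X'.Y.comap (i.restrictScalars ℚ)
        W := X'.W.comap i
        V := X'.V.comap i
        finite := by
          refine Module.Finite.of_injective
            ((i.restrictScalars ℚ).restrict (p := X'.Y.comap (i.restrictScalars ℚ)) (q := X'.Y)
              fun x hx => hx) ?_
          intro x y hxy
          apply Subtype.ext
          apply hinj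
          have := congrArg Subtype.val hxy
          simpa using this
        isLog := by
          intro y hy
          refine ⟨fun k => ?_, fun j => Fin.elim0 j⟩
          rw [Subsingleton.elim k 0]
          have hmem : (i y).1 k₀ ∈ padicQbar p := (X'.isLog _ hy).1 k₀
          rw [hi, Prod.smul_fst, Pi.smul_apply, smul_eq_mul] at hmem
          have : y.1 0 = y.1 0 * v.1 k₀ * (v.1 k₀)⁻¹ := by
            rw [mul_assoc, mul_inv_cancel₀ hk₀, mul_one]
          rw [this]
          exact mul_mem hmem (inv_mem (hv1 k₀))
        isRat := isQbarRational_of_one_zero _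
        hYV := fun y hy => X'.hYV hy
        hWV := Submodule.comap_mono X'.hWV }
    have hAV : A.V = ⊤ := by
      rw [eq_top_iff]
      intro p _
      show i p ∈ X'.V
      rw [hi]
      exact Submodule.smul_mem _ _ hvV
    refine ⟨A, i, ⟨hinj, hbi, rfl, rfl, rfl⟩, rfl, ?_, ?_⟩
    · show 1 + 0 - finrank (PadicAlgCl p) A.V = 0
      rw [hAV, finrank_top, finrank_linTangent]
      rfl
    · show (1 : ℕ) + 0 ≠ 0
      norm_num
  · rintro h ⟨A, i, ⟨hinj, hbi, -, -, hAV⟩, hd₁, hb, hr⟩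
    have hd₀ : 0 < A.d₀ := by
      change A.d₁ = 0 at hd₁
      unfold fr at hr
      omega
    -- `V* = K^{d₀*} × K^{d₁*}`
    have hVtop : A.V = ⊤ := by
      apply Submodule.eq_top_of_finrank_eq
      rw [finrank_linTangent]
      have := A.finrank_V_le
      unfold fb at hb
      omega
    -- `(e₁, 0) ↦` a non-zero point of `V' ∩ (ℚ̄^{d₀'} × 0)`
    set e : LinTangent p A.d₀ A.d₁ := (Pi.single ⟨0, hd₀⟩ 1, 0) with he
    have healg : ∀ k, (Pi.single (⟨0, hd₀⟩ : Fin A.d₀) (1 : PadicAlgCl p) : Fin A.d₀ → PadicAlgCl p) k ∈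
        padicQbar p := by
      intro k
      by_cases hk : k = ⟨0, hd₀⟩
      · subst hk; simp
      · simp [hk]
    obtain ⟨h1, h2⟩ := hbi.1 _ healg
    have heV : i e ∈ X'.V := by
      have : e ∈ A.V := by rw [hVtop]; trivial
      rwa [hAV] at this
    have hie : i e = 0 := h _ heV h1 h2
    have he0 : e = 0 := hinj (by rw [hie, map_zero])
    have := congrArg (fun p : LinTangent p A.d₀ A.d₁ => p.1 ⟨0, hd₀⟩) he0
    simp [he] at this

/-! ### Theorem 1bis and the minimality condition of Theorem 2, object by object -/

/-- For a cokernel `(X, X', s)`: `b(X') ≠ 0 ↔ s(V) ≠ K^{d₀'} × K^{d₁'}`. [folklore] -/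
theorem IsCokerMap.fb_ne_zero_iff {X X' : Obj p} {s : LinTangent p X.d₀ X.d₁ →ₗ[PadicAlgCl p] LinTangent p X'.d₀ X'.d₁}
    (hs : X.IsCokerMap X' s) : fb X' ≠ 0 ↔ X.V.map s ≠ ⊤ := by
  rw [Obj.fb_ne_zero_iff, hs.2.2.2]

/-- **Theorem 1bis from Theorem 1**, object by object: if `b(X) ≠ 0` (i.e. `V ≠ K^{d₀} × K^{d₁}`),
Theorem 1 (here a HYPOTHESIS, `IsThmOneDatum → ThmOneConclusion`) gives an admissible `s` with, for
`X' = s(X)`, `b(X') + d(X') ≠ 0` and `(a(X') + c(X'))/(b(X') + d(X')) ≤ a(X)/b(X)`.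
[cite: Roy1992, §2 Theorem 1bis (p. 27)] -/
theorem exists_mapObj_of_thmOne
    (h : ∀ ⦃d₀ d₁ : ℕ⦄ (Y : Submodule ℚ (LinTangent p d₀ d₁))
      (W V : Submodule (PadicAlgCl p) (LinTangent p d₀ d₁)),
      IsThmOneDatum Y W V → V ≠ ⊤ → ThmOneConclusion Y W V)
    (X : Obj p) (hb : fb X ≠ 0) :
    ∃ (d₀' d₁' : ℕ) (s : LinTangent p X.d₀ X.d₁ →ₗ[PadicAlgCl p] LinTangent p d₀' d₁') (hs : IsAdmissible s),
      fb (X.mapObj s hs.2) + fd (X.mapObj s hs.2) ≠ 0 ∧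
        ((fa (X.mapObj s hs.2) : ℝ) + fc (X.mapObj s hs.2)) /
            ((fb (X.mapObj s hs.2) : ℝ) + fd (X.mapObj s hs.2)) ≤ (fa X : ℝ) / fb X := by
  obtain ⟨d₀', d₁', s, hs, hW, hineq⟩ :=
    h X.Y X.W X.V ⟨X.finite, X.isLog, X.isRat, X.hYV, X.hWV⟩ ((fb_ne_zero_iff X).1 hb)
  refine ⟨d₀', d₁', s, hs, ?_, ?_⟩
  · rw [fb_add_fd_ne_zero_iff]
    exact hW
  · rw [cast_fb_add_fd, cast_fa, cast_fa, cast_fb]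
    exact hineq

/-- **The minimality of Theorem 2 is the minimality of Theorem 2bis**: for a cokernel `(X, X', s)`,
`s` minimises `d₁'/(d₀' + d₁' − dim_K(s(V)))` among the admissible maps with `s(V) ≠ K^{d₀'} × K^{d₁'}`
(`IsThm2Minimal`) iff `b(X') ≠ 0` and `d₁(X')/b(X') ≤ d₁(X'')/b(X'')` for every cokernel
`(X, X'', s'')` with `b(X'') ≠ 0`. [cite: Roy1992, §1 Theorem 2 (p. 25) and §2 Theorem 2bis (p. 27)] -/
theorem IsCokerMap.isThm2Minimal_iff {X X' : Obj p}
    {s : LinTangent p X.d₀ X.d₁ →ₗ[PadicAlgCl p] LinTangent p X'.d₀ X'.d₁} (hs : X.IsCokerMap X' s) :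
    IsThm2Minimal X.V X'.d₀ X'.d₁ s ↔
      fb X' ≠ 0 ∧ ∀ (X'' : Obj p) (s'' : LinTangent p X.d₀ X.d₁ →ₗ[PadicAlgCl p] LinTangent p X''.d₀ X''.d₁),
        X.IsCokerMap X'' s'' → fb X'' ≠ 0 → (fd₁ X' : ℝ) / fb X' ≤ (fd₁ X'' : ℝ) / fb X'' := by
  constructor
  · rintro ⟨-, htop, hmin⟩
    refine ⟨hs.fb_ne_zero_iff.2 htop, fun X'' s'' hs'' hb'' => ?_⟩
    rw [← thm2Ratio_eq hs, ← thm2Ratio_eq hs'']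
    exact hmin X''.d₀ X''.d₁ s'' hs''.1 (hs''.fb_ne_zero_iff.1 hb'')
  · rintro ⟨hb', hmin⟩
    refine ⟨hs.1, hs.fb_ne_zero_iff.1 hb', fun d₀'' d₁'' s'' hs'' htop'' => ?_⟩
    have hc := X.isCokerMap_mapObj hs''
    have h := hmin _ s'' hc (hc.fb_ne_zero_iff.2 htop'')
    rwa [← thm2Ratio_eq hs, ← thm2Ratio_eq hc] at h

end Obj

end Literature.NumberTheory.Transcendental.RoyPadic
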